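import Summits.BirchSwinnertonDyer.BirchSwinnertonDyer.Theorems.ClassRecordThreeEulerHalvesAtThreeCartanDegreeOfStubs
import Summits.BirchSwinnertonDyer.BirchSwinnertonDyer.Theorems.ClassRecordThreeEulerHalvesAtThreeCartanDegreeValDefs
import HarnessLib

/-!
# Crux 23422 `EulerHalvesAtThreeResidualUpperBound`, line `cartan`: the Cartan degree law (F2) RE-DERIVED from the 3-adic dictionary (F2b♭)
# `CartanHomLatticeDictionaryAtThreeVal` in place of (F2b); (F2b) ⇒ (F2b♭); and the lattice-layer residual of the exact (F2b)
# (every torus–degree datum forces a perfect square; every Cartan torus lattice with non-zero torus-fixed generators carries a datum)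

Seat `bsd-stepL-cartan-f2b` (g0; explicit-unit research prover on the registered stub (F2b) of `Lines/cartan.lean` v8′;
`--supports stmt-BirchSwinnertonDyer-23422 --as helper`). Theorems only; sorry-free; axioms trio.
* §1 `dictionaryVal_of_dictionary : CartanHomLatticeDictionaryAtThree → CartanHomLatticeDictionaryAtThreeVal` — the registered (F2b) implies the
  repaired (F2b♭) (`…CartanDegreeValDefs`), so nothing already built on v8′ is lost by the re-key.
* §2 `degreeLaw_aux_val`, `cartanDegreeLawAtThree_derived_val` — bsd-idea-10 g10's induction on `#C` (`…CartanDegreeOfStubs`, p678319) with the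
  hypothesis `hF2b : CartanHomLatticeDictionaryAtThree` REPLACED by `hF2b : CartanHomLatticeDictionaryAtThreeVal`; the proof is token-identical except
  the last step, where the datum's degrees enter through `ord₃` only (`latticeDegreeLaw_of_periodRatio` is an `ord₃` statement). CONCLUSION
  TOKEN-IDENTICAL to `cartanDegreeLawAtThree_derived`, so the skeleton's `cartanDegreeLawAtThree_of_items` re-derives from the stubs (F2a), (F2⁰),
  (F2b♭) by a one-word edit (turnkey v9, HOME/cartan-f2b/g0).
* §3 the LATTICE-LAYER RESIDUAL of the exact (F2b): `isSquare_of_degreeData` — for every torus–degree datum at `q > 1`,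
  `(q²−1)·degX0·degC·B(w_s,w_s)·B(w_C,w_C)` is a perfect square (so the exact (F2b), which pins `degX0 = Q'.deg`, `degC = Q.deg`, asserts a
  square-class identity at every prime `ℓ ≠ 3` — the over-statement documented in `…CartanDegreeValDefs`); and
  `CartanTorusDegreeData.exists_ofGenerators` — every Cartan torus lattice with non-zero generators of the two torus-fixed lines carries a torus–degree
  datum (`idx_T = 1`, `c = ½(q−1)²(q²−1)`, `degX0 = B(w_s,w_s)·(q²−1)`, `degC = B(w_C,w_C)·(q−1)²`), whence (with the lattice law) the residual of
  (F2b♭) beyond finite-group theory is exactly the one-place relation `ord₃ Q'.deg = ord₃ Q.deg + 1`.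
CREDIT: bsd-idea-10 g7–g10 (the induction, VERBATIM up to the last step), tam3-p1 g20 (tree files p677910 ∕ p678128 ∕ p678319). HONEST FRAMING:
CONDITIONAL on the displayed hypotheses; the degree law (F2) is NOT proved (three open inputs, (F2b♭) beyond print); nothing is asserted about any
curve; no summit statement, no route item is proved; BSD is proved for no curve. References: [cite: KohenPacetti2016, Rem. 3.8 (p. 15), §2]
[cite: CaiShuTian2014, §1.2 p. 5] [cite: VignerasLNM800, Ch. III §5] [cite: PastenShimura2024, §2 p. 12 (admissible factorisation)].
-- adapted from Summits/BirchSwinnertonDyer/BirchSwinnertonDyer/Theorems/ClassRecordThreeEulerHalvesAtThreeCartanDegreeOfStubs.lean (p678319) §4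
-/

set_option linter.dupNamespace false -- the layout namespace `Summit.BirchSwinnertonDyer.BirchSwinnertonDyer.…` repeats the summit name (D-0017; as the sibling Defs)
set_option autoImplicit false

noncomputable section

open scoped Classical MatrixGroups NumberField UpperHalfPlane

namespace Summit.BirchSwinnertonDyer.BirchSwinnertonDyer.Theorems.CartanDegree

open WeierstrassCurve IsDedekindDomain NumberField Field Literature.NumberTheory.EllipticCurves
  Literature.NumberTheory.EllipticCurves.ModularForms
  Literature.NumberTheory.EllipticCurves.Rank1Residual Literature.NumberTheory.Automorphic
  Summit.BirchSwinnertonDyer.Rank1Residual Summit.BirchSwinnertonDyer.BirchSwinnertonDyer.Theorems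

/-! ## §1 The registered (F2b) implies the 3-adic (F2b♭) -/

/-- PROVED: the exact dictionary (F2b) implies its 3-adic form (F2b♭) (take the same datum; equal degrees have equal `ord₃`). [folklore] -/
theorem dictionaryVal_of_dictionary (h : CartanHomLatticeDictionaryAtThree) : CartanHomLatticeDictionaryAtThreeVal := by
  intro V _ _ hX hsurj N D M C q _ X W₁ _ Q X' W₂ _ Q' hVN hDMN hq hq3 hq3N hcq hQ hQ'
  obtain ⟨𝒟, h0, h1⟩ := h V hX hsurj N D M C q X W₁ Q X' W₂ Q' hVN hDMN hq hq3 hq3N hcq hQ hQ'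
  exact ⟨𝒟, by rw [h0], by rw [h1]⟩

/-! ## §2 The derivation of (F2) from (F3), (F2a), (F2⁰) and the 3-adic (F2b♭) (bsd-idea-10 g10's induction, last step through `ord₃`) -/

section Derivation

/-- THE INDUCTION on the number of Cartan places, along the chain `(D, M; C) → (D, Mq²; C∖q) → … → (D, M₀; ∅)` with a FIXED
class-minimal datum `Qt` at the top level `(D, M₀; ∅)` — VERBATIM `degreeLaw_aux` (p678319) with the 3-adic dictionary (F2b♭). [folklore] -/
theorem degreeLaw_aux_val (hF3 : nonempty_cartanParametrizationData)
    (hF20 : CartanEmptyDegreeIndep) (hF2b : CartanHomLatticeDictionaryAtThreeVal) (h2a : CubicTorusPeriodRatioAtThree)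
    (V : WeierstrassCurve ℚ) [V.IsElliptic] [V.IsGloballyMinimal] (hX : ClassX11b V 3) (hsurj : Surj V 3)
    (N D M₀ : ℕ) (hVN : V.conductorNorm ℤ = N) (hadm : IsAdmissibleFactorization N D M₀)
    (Xt : CartanLevelCurveData D M₀ ∅) (Wt : WeierstrassCurve ℚ) [Wt.IsElliptic]
    (Qt : CartanParametrizationData Xt Wt) (hQt : Qt.IsMinimalFor V) :
    ∀ (k : ℕ) (C : Finset ℕ) (M : ℕ), C.card = k → M * ∏ q ∈ C, q ^ 2 = M₀ →
      (∀ q ∈ C, ∃ _ : Fact q.Prime, q ≠ 3 ∧ q ^ 2 ∣ N ∧ ¬ q ^ 3 ∣ N ∧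
        3 ∣ (V.baseChange ℚ_[q]).localTamagawaNumber ℤ_[q]) →
      ∀ (XC : CartanLevelCurveData D M C) (W'' : WeierstrassCurve ℚ) [W''.IsElliptic]
        (Q₀ : CartanParametrizationData XC W''), Q₀.IsMinimalFor V →
        padicValNat 3 Q₀.deg + C.card = padicValNat 3 Qt.deg := by
  intro k
  induction k with
  | zero =>
    intro C M hcard hM hC XC W'' _ Q₀ hQ₀
    have hC0 : C = ∅ := Finset.card_eq_zero.mp hcard
    subst hC0
    simp only [Finset.prod_empty, mul_one] at hM
    subst hM
    have h := hF20 V D M XC W'' Q₀ Xt Wt Qt hQ₀ hQt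
    simp [h]
  | succ k ih =>
    intro C M hcard hM hC XC W'' _ Q₀ hQ₀
    obtain ⟨q, hq⟩ : C.Nonempty := Finset.card_pos.mp (by omega)
    obtain ⟨hfq, hq3, _, hq3N, hcq⟩ := hC q hq
    have hXcop := XC.coprime
    have hqP : q.Prime := (hXcop q hq).1
    -- the intermediate level `(D, M q²; C ∖ q)`
    have hcard' : (C.erase q).card = k := by rw [Finset.card_erase_of_mem hq, hcard]; rfl
    have hM' : M * q ^ 2 * ∏ p ∈ C.erase q, p ^ 2 = M₀ := by
      rw [mul_assoc, Finset.mul_prod_erase C (fun p => p ^ 2) hq, hM]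
    have hDpos : 0 < D := hadm.pos_left
    have hM₀pos : 0 < M₀ := hadm.pos_right
    have hM'pos : 0 < M * q ^ 2 := by
      rcases Nat.eq_zero_or_pos (M * q ^ 2) with h0 | h0
      · rw [h0, zero_mul] at hM'; omega
      · exact h0
    have hM'dvd : M * q ^ 2 ∣ M₀ := Dvd.intro _ hM'
    have hadm' : IsAdmissibleFactorization (D * (M * q ^ 2)) D (M * q ^ 2) :=
      ⟨Nat.mul_pos hDpos hM'pos, rfl, hadm.squarefree, hadm.even_card_primeFactors,
        Nat.Coprime.coprime_dvd_right hM'dvd hadm.coprime⟩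
    have hN' : N = D * (M * q ^ 2) * ∏ p ∈ C.erase q, p ^ 2 := by
      rw [← hadm.mul_eq, ← hM']; ring
    have hCp' : ∀ p ∈ C.erase q, p.Prime ∧ ¬ p ∣ D * (M * q ^ 2) := by
      intro p hp
      have hpq : p ≠ q := Finset.ne_of_mem_erase hp
      have hpC : p ∈ C := Finset.mem_of_mem_erase hp
      refine ⟨(hXcop p hpC).1, fun hdvd => ?_⟩
      rw [← mul_assoc] at hdvd
      rcases (Nat.Prime.dvd_mul (hXcop p hpC).1).mp hdvd with h1 | h1
      · exact (hXcop p hpC).2 h1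
      · exact hpq ((Nat.prime_dvd_prime_iff_eq (hXcop p hpC).1 hqP).mp ((hXcop p hpC).1.dvd_of_dvd_pow h1))
    have hc' : ∀ p ∈ C.erase q, ∃ _ : Fact p.Prime, 3 ∣ (V.baseChange ℚ_[p]).localTamagawaNumber ℤ_[p] := by
      intro p hp
      obtain ⟨hf, -, -, -, h3⟩ := hC p (Finset.mem_of_mem_erase hp)
      exact ⟨hf, h3⟩
    obtain ⟨X', W₂, hW₂, Q', hQ'⟩ := exists_isMinimalFor_of_F3 hF3 hadm' hN' hCp' V hVN hc'
    -- induction hypothesis on the intermediate datum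
    have ih' := ih (C.erase q) (M * q ^ 2) hcard' hM'
      (fun p hp => hC p (Finset.mem_of_mem_erase hp)) X' W₂ Q' hQ'
    -- the one-place dictionary (3-adic form) and S-K1′
    have hDMN : D * M * ∏ p ∈ C, p ^ 2 = N := by rw [← hadm.mul_eq, ← hM]; ring
    obtain ⟨𝒟, h0, h1⟩ := hF2b V hX hsurj N D M C q XC W'' Q₀ X' W₂ Q'
      hVN hDMN hq hq3 hq3N hcq hQ₀ hQ'
    have hlaw := latticeDegreeLaw_of_periodRatio h2a q hqP hq3 𝒟
    rw [h0, h1] at hlaw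
    rw [hcard]
    rw [hcard'] at ih'
    omega

/-- **(F2) DERIVED from (F2a), (F2⁰), the 3-adic (F2b♭) and the (F3) item as a hypothesis — conclusion TOKEN-IDENTICAL to
`cartanDegreeLawAtThree_derived` (p678319), hence to the skeleton's `cartanDegreeLawAtThree_of_items`.** Proof verbatim: `N > 0`;
Pasten-admissibility of `(N, ∏S, N/∏S)`; `∏_C q² ∣ N/∏S`; the top datum is the transport `cartanOfShimura X`, `cpdOfSpd P₀` (class-minimal by
`isMinimalFor_cpdOfSpd`); then `degreeLaw_aux_val` with `k = #C`. [folklore] -/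
theorem cartanDegreeLawAtThree_derived_val (hF3 : nonempty_cartanParametrizationData) (hF2a : CubicTorusPeriodRatioAtThreeGeFive)
    (hF20 : CartanEmptyDegreeIndep) (hF2b : CartanHomLatticeDictionaryAtThreeVal) :
    ∀ (V : WeierstrassCurve ℚ) [V.IsElliptic] [V.IsGloballyMinimal], ClassX11b V 3 → Surj V 3 →
      ∀ (N : ℕ) (S C : Finset ℕ)
        (X : ShimuraCurveData (∏ q ∈ S, q) (N / ∏ q ∈ S, q))
        (W' : WeierstrassCurve ℚ) [W'.IsElliptic] (P₀ : ShimuraParametrizationData X W')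
        (XC : Literature.NumberTheory.Automorphic.CartanLevelCurveData (∏ q ∈ S, q) (N / ((∏ q ∈ S, q) * ∏ q ∈ C, q ^ 2)) C)
        (W'' : WeierstrassCurve ℚ) [W''.IsElliptic] (Q₀ : Literature.NumberTheory.Automorphic.CartanParametrizationData XC W''),
        V.conductorNorm ℤ = N → (∀ ℓ ∈ S, ℓ.Prime ∧ ℓ ∣ N ∧ ¬ ℓ ^ 2 ∣ N) → Even S.card →
        (∀ q ∈ C, ∃ _ : Fact q.Prime, q ≠ 3 ∧ q ^ 2 ∣ N ∧ ¬ q ^ 3 ∣ N ∧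
          3 ∣ (V.baseChange ℚ_[q]).localTamagawaNumber ℤ_[q]) →
        P₀.IsMinimalFor V → Q₀.IsMinimalFor V →
        padicValNat 3 Q₀.deg + C.card = padicValNat 3 P₀.deg := by
  intro V _ _ hX hsurj N S C X W' _ P₀ XC W'' _ Q₀ hN hS hSe hC hP₀ hQ₀
  have hNpos : 0 < N := by
    have h : 0 < V.conductorNorm ℤ := V.conductorNorm_pos_holds
    rwa [hN] at h
  have hadm := isAdmissibleFactorization_prod_of_even hNpos hS hSe
  have hDpos : 0 < ∏ q ∈ S, q := hadm.pos_left
  -- `∏_C q² ∣ N / ∏S`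
  have hCprime : ∀ q ∈ C, q.Prime := fun q hq => (hC q hq).1.out
  have hPC : ∏ q ∈ C, q ^ 2 ∣ N / ∏ q ∈ S, q := by
    refine prod_pow_dvd_of_forall_dvd 2 _ C hCprime fun q hq => ?_
    obtain ⟨hfq, -, hq2N, -, -⟩ := hC q hq
    have hqS : Nat.Coprime (q ^ 2) (∏ ℓ ∈ S, ℓ) := by
      refine Nat.Coprime.pow_left 2 (Nat.Coprime.prod_right fun ℓ hℓ => ?_)
      refine (Nat.coprime_primes hfq.out (hS ℓ hℓ).1).mpr fun h => ?_
      subst h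
      exact (hS q hℓ).2.2 hq2N
    rw [← hadm.mul_eq] at hq2N
    exact hqS.dvd_of_dvd_mul_left hq2N
  have hPpos : 0 < ∏ q ∈ C, q ^ 2 := Finset.prod_pos fun q hq => pow_pos (hCprime q hq).pos 2
  obtain ⟨M, hM⟩ := hPC
  have hMeq : N / ((∏ q ∈ S, q) * ∏ q ∈ C, q ^ 2) = M := by
    rw [← Nat.div_div_eq_div_mul, hM, Nat.mul_div_cancel_left M hPpos]
  have hlevel : N / ((∏ q ∈ S, q) * ∏ q ∈ C, q ^ 2) * ∏ q ∈ C, q ^ 2 = N / ∏ q ∈ S, q := by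
    rw [hMeq, hM, mul_comm]
  have key := degreeLaw_aux_val hF3 hF20 hF2b (cubicTorusPeriodRatioAtThree_of_geFive hF2a) V hX hsurj N (∏ q ∈ S, q) (N / ∏ q ∈ S, q)
    hN hadm (cartanOfShimura X) W' (cpdOfSpd P₀) (isMinimalFor_cpdOfSpd hP₀) C.card C _ rfl hlevel hC XC W'' Q₀ hQ₀
  simpa using key

end Derivation

/-! ## §3 The lattice-layer residual of the EXACT (F2b): a forced perfect square; a datum on every lattice -/

section LatticeLayer

/-- PROVED — **the exact sheet counts force a perfect square**: for every torus–degree datum at `q > 1`,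
`(q²−1)·degX0·degC·B(w_s,w_s)·B(w_C,w_C)` is a square in `ℤ`. (Eliminating `c` from `sheet_s`, `sheet_C`:
`idx_s²·B(w_s,w_s)·(q+1)·degC = idx_C²·B(w_C,w_C)·(q−1)·degX0`; multiply by `(q−1)·degX0·B(w_C,w_C)·idx_C²`.) Consequence: the registered
(F2b), which asks such a datum with `degX0 = Q'.deg`, `degC = Q.deg`, asserts that `(q²−1)·Q'.deg·Q.deg·B(w_s,w_s)·B(w_C,w_C)` is a perfect
square — a square-class identity at EVERY prime, of which only the `3`-part (the degree law) is in the paper proof or used by the crux;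
the 3-adic (F2b♭) drops it. [folklore] -/
theorem isSquare_of_degreeData {q : ℕ} (𝒟 : CartanTorusDegreeData q) (hq : 1 < q) :
    IsSquare ((((q : ℤ) ^ 2 - 1) * 𝒟.degX0 * 𝒟.degC) *
      (𝒟.toCartanTorusLattice.B 𝒟.wS 𝒟.wS * 𝒟.toCartanTorusLattice.B 𝒟.wC 𝒟.wC)) := by
  set L := 𝒟.toCartanTorusLattice with hL
  set βS : ℤ := L.B 𝒟.wS 𝒟.wS with hβS
  set βC : ℤ := L.B 𝒟.wC 𝒟.wC with hβC
  set bS : ℤ := L.B 𝒟.uS 𝒟.uS with hbS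
  set bC : ℤ := L.B 𝒟.uC 𝒟.uC with hbC
  have hq1 : (1 : ℚ) < (q : ℚ) := by exact_mod_cast hq
  have hcne : 𝒟.c ≠ 0 := ne_of_gt 𝒟.c_pos
  -- eliminate the normalisation `c` (as in `latticeDegreeLaw_of_periodRatio`)
  have key : (bS : ℚ) * ((q : ℚ) + 1) * (𝒟.degC : ℚ) = (bC : ℚ) * ((q : ℚ) - 1) * (𝒟.degX0 : ℚ) := by
    have h1 := 𝒟.sheet_s
    have h2 := 𝒟.sheet_C
    have hq1'' : (q : ℚ) - 1 ≠ 0 := by linarith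
    have e : ((bS : ℚ) * ((q : ℚ) + 1) * (𝒟.degC : ℚ)) * (𝒟.c * ((q : ℚ) - 1))
        = ((bC : ℚ) * ((q : ℚ) - 1) * (𝒟.degX0 : ℚ)) * (𝒟.c * ((q : ℚ) - 1)) := by
      calc ((bS : ℚ) * ((q : ℚ) + 1) * (𝒟.degC : ℚ)) * (𝒟.c * ((q : ℚ) - 1))
          = (𝒟.c * (bS : ℚ)) * (((q : ℚ) ^ 2 - 1) * (𝒟.degC : ℚ)) := by ring
        _ = (((q : ℚ) - 1) ^ 2 / 2 * (𝒟.degX0 : ℚ)) * (((q : ℚ) ^ 2 - 1) * (𝒟.degC : ℚ)) := by rw [h1]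
        _ = (((q : ℚ) ^ 2 - 1) / 2 * (𝒟.degC : ℚ)) * (((q : ℚ) - 1) ^ 2 * (𝒟.degX0 : ℚ)) := by ring
        _ = (𝒟.c * (bC : ℚ)) * (((q : ℚ) - 1) ^ 2 * (𝒟.degX0 : ℚ)) := by rw [h2]
        _ = ((bC : ℚ) * ((q : ℚ) - 1) * (𝒟.degX0 : ℚ)) * (𝒟.c * ((q : ℚ) - 1)) := by ring
    exact mul_right_cancel₀ (mul_ne_zero hcne hq1'') e
  have keyZ : bS * ((q : ℤ) + 1) * (𝒟.degC : ℤ) = bC * ((q : ℤ) - 1) * (𝒟.degX0 : ℤ) := by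
    exact_mod_cast key
  have hbS_eq : bS = 𝒟.idxS * 𝒟.idxS * βS := by
    simp only [hbS, hβS, 𝒟.uS_eq, map_smul, LinearMap.smul_apply, smul_eq_mul]; ring
  have hbC_eq : bC = 𝒟.idxC * 𝒟.idxC * βC := by
    simp only [hbC, hβC, 𝒟.uC_eq, map_smul, LinearMap.smul_apply, smul_eq_mul]; ring
  have hidxS : 𝒟.idxS ≠ 0 := fun h0 => 𝒟.descent_s (by rw [h0]; exact dvd_zero 3)
  have hidxC : 𝒟.idxC ≠ 0 := fun h0 => 𝒟.descent_C (by rw [h0]; exact dvd_zero 3)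
  rw [hbS_eq, hbC_eq] at keyZ
  -- `(idx_s idx_C)² · P = m²` with `m := idx_C² β_C (q−1) degX0`
  set P : ℤ := (((q : ℤ) ^ 2 - 1) * 𝒟.degX0 * 𝒟.degC) * (βS * βC) with hP
  set m : ℤ := 𝒟.idxC * 𝒟.idxC * βC * ((q : ℤ) - 1) * (𝒟.degX0 : ℤ) with hm
  have e : m ^ 2 = (𝒟.idxS * 𝒟.idxC) ^ 2 * P := by
    rw [hm, hP]
    linear_combination (-(𝒟.idxC * 𝒟.idxC * βC * ((q : ℤ) - 1) * (𝒟.degX0 : ℤ))) * keyZ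
  have hs : 𝒟.idxS * 𝒟.idxC ≠ 0 := mul_ne_zero hidxS hidxC
  obtain ⟨k, hk⟩ := (Int.pow_dvd_pow_iff two_ne_zero).mp ⟨P, e⟩
  refine ⟨k, ?_⟩
  have hs2 : (𝒟.idxS * 𝒟.idxC) ^ 2 ≠ 0 := pow_ne_zero 2 hs
  apply mul_left_cancel₀ hs2
  rw [← e, hk]; ring

/-- PROVED — **every Cartan torus lattice with non-zero generators of the two torus-fixed lines carries a torus–degree datum** (`q > 1`):
`u_T := w_T` (`idx_T = 1`), `c := ½(q−1)²(q²−1)`, `degX0 := B(w_s,w_s)·(q²−1)`, `degC := B(w_C,w_C)·(q−1)²`. So torus–degree data are never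
the obstruction: the content of (F2b♭) beyond the finite-group supply of a lattice is the one-place `ord₃` relation between the datum's degrees and
`Q.deg`, `Q'.deg` (by the lattice law every datum has `ord₃ degX0 = ord₃ degC + 1`; rescaling `c` by `3^{±k}` within integrality moves both
valuations together, so a lattice realises `(Q'.deg, Q.deg)` 3-adically iff `ord₃ Q'.deg = ord₃ Q.deg + 1`). [folklore] -/
theorem CartanTorusDegreeData.exists_ofGenerators {q : ℕ} (hq : 1 < q) (𝓛 : CartanTorusLattice q) (wS wC : Fin 𝓛.d → ℤ)
    (hS : 𝓛.IsSplitFixed wS) (hC : 𝓛.IsNonsplitFixed wC)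
    (hSg : ∀ v, 𝓛.IsSplitFixed v → ∃ m : ℤ, v = m • wS) (hCg : ∀ v, 𝓛.IsNonsplitFixed v → ∃ m : ℤ, v = m • wC)
    (hwS : wS ≠ 0) (hwC : wC ≠ 0) :
    ∃ 𝒟 : CartanTorusDegreeData q, 𝒟.toCartanTorusLattice = 𝓛 ∧
      (𝒟.degX0 : ℤ) = 𝓛.B wS wS * ((q : ℤ) ^ 2 - 1) ∧ (𝒟.degC : ℤ) = 𝓛.B wC wC * ((q : ℤ) - 1) ^ 2 := by
  have hBS : 0 < 𝓛.B wS wS := 𝓛.B_pos _ hwS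
  have hBC : 0 < 𝓛.B wC wC := 𝓛.B_pos _ hwC
  have hq1Q : (1 : ℚ) < (q : ℚ) := by exact_mod_cast hq
  have hq2 : 1 ≤ q ^ 2 := Nat.one_le_pow 2 q (by omega)
  have hq1 : 1 ≤ q := by omega
  have eS : (((𝓛.B wS wS).toNat : ℕ) : ℚ) = ((𝓛.B wS wS : ℤ) : ℚ) := by
    rw [← Int.cast_natCast, Int.toNat_of_nonneg hBS.le]
  have eC : (((𝓛.B wC wC).toNat : ℕ) : ℚ) = ((𝓛.B wC wC : ℤ) : ℚ) := by
    rw [← Int.cast_natCast, Int.toNat_of_nonneg hBC.le]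
  have e2 : (((q ^ 2 - 1 : ℕ) : ℕ) : ℚ) = (q : ℚ) ^ 2 - 1 := by
    rw [Nat.cast_sub hq2]; push_cast; ring
  have e3 : (((q - 1 : ℕ) : ℕ) : ℚ) = (q : ℚ) - 1 := by
    rw [Nat.cast_sub hq1]; push_cast; ring
  refine ⟨{ toCartanTorusLattice := 𝓛
            wS := wS
            wC := wC
            wS_fixed := hS
            wC_fixed := hC
            wS_gen := hSg
            wC_gen := hCg
            c := ((q : ℚ) - 1) ^ 2 * ((q : ℚ) ^ 2 - 1) / 2
            c_pos := by
              have h1 : (0 : ℚ) < ((q : ℚ) - 1) ^ 2 := by nlinarith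
              have h2 : (0 : ℚ) < (q : ℚ) ^ 2 - 1 := by nlinarith
              positivity
            uS := wS
            uC := wC
            idxS := 1
            idxC := 1
            uS_eq := (one_smul ℤ wS).symm
            uC_eq := (one_smul ℤ wC).symm
            descent_s := by decide
            descent_C := by decide
            degX0 := (𝓛.B wS wS).toNat * (q ^ 2 - 1)
            degC := (𝓛.B wC wC).toNat * (q - 1) ^ 2
            degX0_pos := by
              have h1 : 0 < (𝓛.B wS wS).toNat := by omega
              have h2 : 0 < q ^ 2 - 1 := by
                have : 1 < q ^ 2 := by nlinarith
                omega
              exact Nat.mul_pos h1 h2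
            degC_pos := by
              have h1 : 0 < (𝓛.B wC wC).toNat := by omega
              have h2 : 0 < (q - 1) ^ 2 := pow_pos (by omega) 2
              exact Nat.mul_pos h1 h2
            sheet_s := by
              push_cast [Nat.cast_mul]
              rw [eS, e2]
              ring
            sheet_C := by
              push_cast [Nat.cast_mul, Nat.cast_pow]
              rw [eC, e3]
              ring }, rfl, ?_, ?_⟩
  · show (((𝓛.B wS wS).toNat * (q ^ 2 - 1) : ℕ) : ℤ) = 𝓛.B wS wS * ((q : ℤ) ^ 2 - 1)
    push_cast [Nat.cast_mul, Nat.cast_sub hq2, Int.toNat_of_nonneg hBS.le]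
    ring
  · show (((𝓛.B wC wC).toNat * (q - 1) ^ 2 : ℕ) : ℤ) = 𝓛.B wC wC * ((q : ℤ) - 1) ^ 2
    push_cast [Nat.cast_mul, Nat.cast_pow, Nat.cast_sub hq1, Int.toNat_of_nonneg hBC.le]
    ring

end LatticeLayer

end Summit.BirchSwinnertonDyer.BirchSwinnertonDyer.Theorems.CartanDegree

end
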